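import Mathlib
import HarnessLib.Audit
import Summits.PneNP.PneNP.Theorems.PstarUnionCaseBFiveTwo
import Summits.PneNP.PneNP.Theorems.PstarMultiUnion

/-!
# Case B of the LOCAL union lemma, at least two chords: `#J₀ ≤ 5` (ROUND-25, memo §14.29 (Rb1) / §14.30; `PstarMultiUnion.LocalUnionFive`)

FRONTIER range-avoidance ladder, rung F-N3, ROUND 25 (cell `pnp-ideate`, planner memo `r24/CORE-BOUND-NOTES.md` §14.29–§14.30, typed target
`PstarMultiUnion.LocalUnionFive` of planner p3 g23; referee g54's node-by-node reading of the landed Case B (STATUS 21:48Z); restricted-model proof complexity —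
nothing here bears on `P` versus `NP`).

The LOCAL union configuration (`PstarMultiUnion.LocalUnionTerminal`: for every output `f` SOME reader `A_f` with `A₀`'s monomials, XOR-agreeing linear part and (T3)
releases `f`), Case B (`w₂` reads a chord private), at least two chords.  The landed two-reader proof (`PstarUnionCaseBFiveTwo.caseB_two_chords`) localises, and
its two «a reader released nowhere ⟹ the other pair is terminal» branches disappear:

* `chords_read_of_one_local` — **B-I**: if `w₂` reads a literal of one chord it reads a literal of every chord `c'`.  The reader `A_{c'}` releasing `c'` has (T3), so it
  touches `c'` (else the release repairs to a solution of `J₀`, A3 `PstarUnionAtoms.satPair_of_erase_chord`), i.e. reads it linearly (hun) and is pinned on `Z` ⟹ `c'` is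
  hard on `Z` (A2); then CORE + reset + B7 as landed;
* `align_reader_local` — **B-II for one pinned reader** (the landed `align_reader` verbatim, B-I supplied by `chords_read_of_one_local`);
* `caseB_two_chords_local` — **`#J₀ ≤ 5`**: the reader `A_{c₀}` releasing the READ chord `c₀` is aligned, its effective reader `A_{c₀} + ε·w₂`
  (`PstarUnionCaseBFiveTwo.exists_effReader`) is chord-blind, and `PstarUnionCaseBFiveTwo.reader_dichotomy` gives `#J₀ ≤ 5` or «no chord releases it» — but `c₀` does.
-/

set_option linter.dupNamespace false -- `Summit.PneNP.PneNP.…`: summit = sub-problem name (D-0017 single-conjunct layout)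

open Finset Module Literature.Computability.Complexity
open scoped symmDiff
open Summit.PneNP.PneNP.Theorems.PstarFibrePolys (bit bit_injective bit_xor)
open Summit.PneNP.PneNP.Theorems.PstarTyped (Typed)
open Summit.PneNP.PneNP.Theorems.PstarSALevel (varSet bdry BoundaryExpanding SimpleOverlap)
open Summit.PneNP.PneNP.Theorems.PstarGapPeeling (not_mem_varSet_of_private eval_pure)
open Summit.PneNP.PneNP.Theorems.PstarCentreFree (vars_mem_varSet)
open Summit.PneNP.PneNP.Theorems.PstarCoreBound (XorClosed)
open Summit.PneNP.PneNP.Theorems.PstarGapOneAll (gval)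
open Summit.PneNP.PneNP.Theorems.PstarChordRepair (IsChord)
open Summit.PneNP.PneNP.Theorems.PstarChordBridgeCotree (Peelable)
open Summit.PneNP.PneNP.Theorems.PstarChordBridgeTools (privs mem_privs)
open Summit.PneNP.PneNP.Theorems.PstarCoreBoundTargets (Terminal)
open Summit.PneNP.PneNP.Theorems.PstarUnion (SatPair)
open Summit.PneNP.PneNP.Theorems.PstarUnionAtoms (Untouched hard_of_pinned_read satPair_of_erase_chord)
open Summit.PneNP.PneNP.Theorems.PstarUnionCaseB (setPair_two setPair_of_ne eval_setPair_of_ne exists_Z_of_sheet aligned_of_pinned)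
open Summit.PneNP.PneNP.Theorems.PstarUnionChordPair (chordPair_surjective)
open Summit.PneNP.PneNP.Theorems.PstarUnionCaseBReads (eval_reset_iff)
open Summit.PneNP.PneNP.Theorems.PstarUnionCaseBAlign (exists_double_sheet)
open Summit.PneNP.PneNP.Theorems.PstarUnionCaseBFiveTwo (exists_effReader reader_dichotomy)
open Summit.PneNP.PneNP.Theorems.PstarMultiUnion (LocalUnionTerminal)

namespace Summit.PneNP.PneNP.Theorems.PstarLocalUnionCaseB

variable {n m : ℕ}

/-! ## B-I, local form -/

/-- **B-I (local form).**  In a local-union-terminal configuration with admissible `F` and hun, if `w₂` reads a literal of one chord then it reads a literal of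
every chord. -/
theorem chords_read_of_one_local (I : LocalMap 4 n m) (hI : I.IsPure xorAndPred) (hT : Typed I) (hS : SimpleOverlap I) {r : ℕ}
    (hE : BoundaryExpanding r I) {y : Fin m → Bool} {J₀ : Finset (Fin m)} {A₀ w₂ : Finset (Fin n) × Finset (Fin m) × Bool}
    (hU : LocalUnionTerminal I r y J₀ A₀ w₂) {F : Finset (Fin m)} (hF : F ⊆ J₀) (hP : Peelable I F)
    (hmax : ∀ F', F ⊆ F' → F' ⊆ J₀ → Peelable I F' → F' = F) (hchord : ∀ e ∈ J₀ \ F, IsChord I J₀ e)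
    (hun : ∀ g ∈ A₀.2.1 ∪ w₂.2.1, ∀ v ∈ privs I (J₀ \ F), I.vars g 2 ≠ v ∧ I.vars g 3 ≠ v)
    {c : Fin m} (hc : c ∈ J₀ \ F) (hread : I.vars c 2 ∈ w₂.1 ∨ I.vars c 3 ∈ w₂.1) :
    ∀ c' ∈ J₀ \ F, I.vars c' 2 ∈ w₂.1 ∨ I.vars c' 3 ∈ w₂.1 := by
  classical
  obtain ⟨-, hX, hJr, -, -, -, -, hloc⟩ := hU
  intro c' hc'
  by_contra hnot
  rw [not_or] at hnot
  have hcc' : c ≠ c' := fun e => by rw [e] at hread; exact hread.elim hnot.1 hnot.2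
  have hcJ : c ∈ J₀ := (mem_sdiff.1 hc).1
  have hc'J : c' ∈ J₀ := (mem_sdiff.1 hc').1
  have hchc := hchord c hc
  have hchc' := hchord c' hc'
  -- gate-freeness from hun
  have gf : ∀ A : Finset (Fin n) × Finset (Fin m) × Bool, A.2.1 ⊆ A₀.2.1 ∪ w₂.2.1 → ∀ e ∈ J₀ \ F,
      ∀ g ∈ A.2.1, I.vars g 2 ≠ I.vars e 2 ∧ I.vars g 3 ≠ I.vars e 2 ∧ I.vars g 2 ≠ I.vars e 3 ∧ I.vars g 3 ≠ I.vars e 3 := by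
    intro A hA e he g hg
    have h2 := hun g (hA hg) _ ((mem_privs I).2 ⟨e, he, Or.inl rfl⟩)
    have h3 := hun g (hA hg) _ ((mem_privs I).2 ⟨e, he, Or.inr rfl⟩)
    exact ⟨h2.1, h2.2, h3.1, h3.2⟩
  have gf₂ := gf w₂ subset_union_right
  -- `w₂` is untouched on the privates of `c'`
  have hw : Untouched I w₂ (I.vars c' 2) ∧ Untouched I w₂ (I.vars c' 3) :=
    ⟨⟨hnot.1, fun g hg => ⟨(gf₂ c' hc' g hg).1, (gf₂ c' hc' g hg).2.1⟩⟩, ⟨hnot.2, fun g hg => ⟨(gf₂ c' hc' g hg).2.2.1, (gf₂ c' hc' g hg).2.2.2⟩⟩⟩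
  -- the reader releasing `c'`: same monomials, (T3)
  obtain ⟨A, hAG, -, hAT3, hArel⟩ := hloc c' hc'J
  have gfA : ∀ e ∈ J₀ \ F, ∀ g ∈ A.2.1, I.vars g 2 ≠ I.vars e 2 ∧ I.vars g 3 ≠ I.vars e 2 ∧ I.vars g 2 ≠ I.vars e 3 ∧ I.vars g 3 ≠ I.vars e 3 :=
    gf A (by rw [hAG]; exact subset_union_left)
  -- it reads `c'` linearly (else the release repairs, A3)
  have hreads : I.vars c' 2 ∈ A.1 ∨ I.vars c' 3 ∈ A.1 := by
    by_contra h
    rw [not_or] at h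
    exact hAT3 (satPair_of_erase_chord I hI hc'J hchc' A w₂
      ⟨⟨h.1, fun g hg => ⟨(gfA c' hc' g hg).1, (gfA c' hc' g hg).2.1⟩⟩, ⟨h.2, fun g hg => ⟨(gfA c' hc' g hg).2.2.1, (gfA c' hc' g hg).2.2.2⟩⟩⟩
      hw hArel)
  -- it is pinned on `Z` (T3)
  have pin : ∀ x x' : Fin n → Bool, (∀ j ∈ J₀, I.eval x j = y j) → gval I w₂.1 w₂.2.1 x = w₂.2.2 →
      (∀ j ∈ J₀, I.eval x' j = y j) → gval I w₂.1 w₂.2.1 x' = w₂.2.2 → gval I A.1 A.2.1 x = gval I A.1 A.2.1 x' := by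
    intro x x' hx hxw hx' hx'w
    have e : ∀ a b t : Bool, a ≠ t → b ≠ t → a = b := by decide
    exact e _ _ A.2.2 (fun h => hAT3 ⟨x, hx, h, hxw⟩) (fun h => hAT3 ⟨x', hx', h, hx'w⟩)
  -- hardness of `c'` on `Z` (A2)
  have hard : ∀ x : Fin n → Bool, (∀ j ∈ J₀, I.eval x j = y j) → gval I w₂.1 w₂.2.1 x = w₂.2.2 →
      x (I.vars c' 2) = true ∧ x (I.vars c' 3) = true := fun x hx hxw =>
    hard_of_pinned_read I hI hc'J hchc' w₂ A hw (gfA c' hc') hreads pin hx hxw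
  -- CORE: violate both chords with privates ON
  obtain ⟨x, hxJ, h2, h3, h2', h3', hcx, hc'x⟩ := chordPair_surjective I hI hT hS hE hX hJr hF hP hmax hchord hc hc' hcc' false false
  have hvc : I.eval x c ≠ y c := fun h => Bool.false_ne_true (hcx.1 h)
  have hvc' : I.eval x c' ≠ y c' := fun h => Bool.false_ne_true (hc'x.1 h)
  -- the privates of `c` and `c'` are distinct variables
  have cross : ∀ s : Fin 4, I.vars c' s ≠ I.vars c 2 ∧ I.vars c' s ≠ I.vars c 3 := by
    intro s
    constructor
    · intro h
      exact not_mem_varSet_of_private I hcJ hc'J hcc'.symm hchc.1 (vars_mem_varSet I c 2) (h ▸ vars_mem_varSet I c' s)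
    · intro h
      exact not_mem_varSet_of_private I hcJ hc'J hcc'.symm hchc.2 (vars_mem_varSet I c 3) (h ▸ vars_mem_varSet I c' s)
  -- reset the pair of `c'` to `(0,0)`
  set x' : Fin n → Bool := Function.update (Function.update x (I.vars c' 2) false) (I.vars c' 3) false with hx'
  have hx'J : ∀ j ∈ J₀, j ≠ c → I.eval x' j = y j := by
    intro j hj hjc
    by_cases hjc' : j = c'
    · subst hjc'
      exact (eval_reset_iff I hI j x h2' h3' (y j)).2 hvc'
    · rw [hx', eval_setPair_of_ne I hc'J hchc' x false false hj hjc']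
      exact hxJ j hj hjc hjc'
  have hx'c2 : x' (I.vars c 2) = true := by rw [hx', setPair_of_ne I c' x false false (cross 2).1.symm (cross 3).1.symm]; exact h2
  have hx'c3 : x' (I.vars c 3) = true := by rw [hx', setPair_of_ne I c' x false false (cross 2).2.symm (cross 3).2.symm]; exact h3
  have h0 : I.eval (Function.update (Function.update x' (I.vars c 2) false) (I.vars c 3) false) c = y c := by
    refine (eval_reset_iff I hI c x' hx'c2 hx'c3 (y c)).2 ?_
    rw [hx', eval_setPair_of_ne I hc'J hchc' x false false hcJ hcc']
    exact hvc
  -- B7 on `c` lands in `Z` with `a_{c'} = 0`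
  obtain ⟨a, b, -, hsol, hw₂⟩ := exists_Z_of_sheet I hI hcJ hchc w₂ (gf₂ c hc) hread hx'J h0
  have hon := (hard _ hsol hw₂).1
  rw [setPair_of_ne I c x' a b (cross 2).1 (cross 2).2, hx'] at hon
  have h23 : I.vars c' 2 ≠ I.vars c' 3 := fun h => absurd (hI.2 c' h) (by decide)
  rw [Function.update_of_ne h23, Function.update_self] at hon
  exact Bool.false_ne_true hon

/-! ## B-II for one pinned reader, local form -/

/-- **One sign per reader (local form).**  In a local-union-terminal configuration with admissible `F`, hun, `w₂` reading a literal of `c₀`, and a second chord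
`c₁ ≠ c₀`: a constraint `φ` that is pinned on `Z` and gate-free on every chord's privates has chord part `ε · (chord part of w₂)` for ONE `ε`, at every chord. -/
theorem align_reader_local (I : LocalMap 4 n m) (hI : I.IsPure xorAndPred) (hT : Typed I) (hS : SimpleOverlap I) {r : ℕ} (hE : BoundaryExpanding r I)
    {y : Fin m → Bool} {J₀ : Finset (Fin m)} {A₀ w₂ : Finset (Fin n) × Finset (Fin m) × Bool} (hU : LocalUnionTerminal I r y J₀ A₀ w₂)
    {F : Finset (Fin m)} (hF : F ⊆ J₀) (hP : Peelable I F) (hmax : ∀ F', F ⊆ F' → F' ⊆ J₀ → Peelable I F' → F' = F)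
    (hchord : ∀ e ∈ J₀ \ F, IsChord I J₀ e) (hun : ∀ g ∈ A₀.2.1 ∪ w₂.2.1, ∀ v ∈ privs I (J₀ \ F), I.vars g 2 ≠ v ∧ I.vars g 3 ≠ v)
    {c₀ c₁ : Fin m} (hc₀ : c₀ ∈ J₀ \ F) (hc₁ : c₁ ∈ J₀ \ F) (hne : c₀ ≠ c₁) (hread : I.vars c₀ 2 ∈ w₂.1 ∨ I.vars c₀ 3 ∈ w₂.1)
    (φ : Finset (Fin n) × Finset (Fin m) × Bool)
    (hφ : ∀ e ∈ J₀ \ F, ∀ g ∈ φ.2.1, I.vars g 2 ≠ I.vars e 2 ∧ I.vars g 3 ≠ I.vars e 2 ∧ I.vars g 2 ≠ I.vars e 3 ∧ I.vars g 3 ≠ I.vars e 3)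
    (hpin : ∀ x x' : Fin n → Bool, (∀ j ∈ J₀, I.eval x j = y j) → gval I w₂.1 w₂.2.1 x = w₂.2.2 →
      (∀ j ∈ J₀, I.eval x' j = y j) → gval I w₂.1 w₂.2.1 x' = w₂.2.2 → gval I φ.1 φ.2.1 x = gval I φ.1 φ.2.1 x') :
    ∃ ε : Bool, ∀ c ∈ J₀ \ F, φ.1 ∩ {I.vars c 2, I.vars c 3} = (if ε then w₂.1 ∩ {I.vars c 2, I.vars c 3} else ∅) := by
  classical
  have hX : XorClosed I J₀ := hU.2.1
  have hJr : J₀.card < r := hU.2.2.1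
  have gf₂ : ∀ e ∈ J₀ \ F, ∀ g ∈ w₂.2.1, I.vars g 2 ≠ I.vars e 2 ∧ I.vars g 3 ≠ I.vars e 2 ∧ I.vars g 2 ≠ I.vars e 3 ∧ I.vars g 3 ≠ I.vars e 3 := by
    intro e he g hg
    have h2 := hun g (mem_union_right _ hg) _ ((mem_privs I).2 ⟨e, he, Or.inl rfl⟩)
    have h3 := hun g (mem_union_right _ hg) _ ((mem_privs I).2 ⟨e, he, Or.inr rfl⟩)
    exact ⟨h2.1, h2.2, h3.1, h3.2⟩
  have hall := chords_read_of_one_local I hI hT hS hE hU hF hP hmax hchord hun hc₀ hread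
  -- B8 on each pair `(c₀, c)`
  have B8 : ∀ c ∈ J₀ \ F, c ≠ c₀ →
      (φ.1 ∩ {I.vars c₀ 2, I.vars c₀ 3} = ∅ ∨ φ.1 ∩ {I.vars c₀ 2, I.vars c₀ 3} = w₂.1 ∩ {I.vars c₀ 2, I.vars c₀ 3}) ∧
      (φ.1 ∩ {I.vars c 2, I.vars c 3} = ∅ ∨ φ.1 ∩ {I.vars c 2, I.vars c 3} = w₂.1 ∩ {I.vars c 2, I.vars c 3}) ∧
      (φ.1 ∩ {I.vars c₀ 2, I.vars c₀ 3} = ∅ ↔ φ.1 ∩ {I.vars c 2, I.vars c 3} = ∅) := by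
    intro c hc hcne
    obtain ⟨x, hx, hxw, h0, h2', h3'⟩ :=
      exists_double_sheet I hI hT hS hE hX hJr hF hP hmax hchord w₂ hc₀ hc (Ne.symm hcne) (gf₂ c₀ hc₀) hread
    exact aligned_of_pinned I hI (mem_sdiff.1 hc₀).1 (mem_sdiff.1 hc).1 (hchord c₀ hc₀) (hchord c hc) (Ne.symm hcne) w₂ φ
      ⟨gf₂ c₀ hc₀, gf₂ c hc⟩ ⟨hφ c₀ hc₀, hφ c hc⟩ ⟨hread, hall c hc⟩ hpin hx hxw h0 (by rw [h2', h3']; rfl)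
  by_cases hε : φ.1 ∩ {I.vars c₀ 2, I.vars c₀ 3} = ∅
  · refine ⟨false, fun c hc => ?_⟩
    rw [if_neg Bool.false_ne_true]
    by_cases hcc : c = c₀
    · rw [hcc]; exact hε
    · exact ((B8 c hc hcc).2.2).1 hε
  · refine ⟨true, fun c hc => ?_⟩
    rw [if_pos rfl]
    by_cases hcc : c = c₀
    · rw [hcc]
      exact ((B8 c₁ hc₁ hne.symm).1).resolve_left hε
    · exact ((B8 c hc hcc).2.1).resolve_left fun h => hε (((B8 c hc hcc).2.2).2 h)

/-! ## Case B with two chords, local form -/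

/-- **Case B of `LocalUnionFive`, at least two chords: `#J₀ ≤ 5`.**  Local-union-terminal core, admissible `F`, hun, `w₂` reads a chord private, `#(J₀ ∖ F) ≥ 2`. -/
theorem caseB_two_chords_local (I : LocalMap 4 n m) (hI : I.IsPure xorAndPred) (hT : Typed I) (hS : SimpleOverlap I) {r : ℕ} (hE : BoundaryExpanding r I)
    {y : Fin m → Bool} {J₀ : Finset (Fin m)} {A₀ w₂ : Finset (Fin n) × Finset (Fin m) × Bool} (hU : LocalUnionTerminal I r y J₀ A₀ w₂)
    {F : Finset (Fin m)} (hF : F ⊆ J₀) (hP : Peelable I F) (hmax : ∀ F', F ⊆ F' → F' ⊆ J₀ → Peelable I F' → F' = F)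
    (hchord : ∀ e ∈ J₀ \ F, IsChord I J₀ e) (hun : ∀ g ∈ A₀.2.1 ∪ w₂.2.1, ∀ v ∈ privs I (J₀ \ F), I.vars g 2 ≠ v ∧ I.vars g 3 ≠ v)
    (hread : ∃ v ∈ privs I (J₀ \ F), v ∈ w₂.1) (htwo : 2 ≤ (J₀ \ F).card) : J₀.card ≤ 5 := by
  classical
  have hU' := hU
  obtain ⟨-, hX, hJr, hd₀, hd₂, hcard, -, hloc⟩ := hU
  -- a read chord `c₀` and another chord `c₁`
  obtain ⟨v, hv, hvw⟩ := hread
  obtain ⟨c₀, hc₀, hv'⟩ := (mem_privs I).1 hv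
  have hread₀ : I.vars c₀ 2 ∈ w₂.1 ∨ I.vars c₀ 3 ∈ w₂.1 := by
    rcases hv' with h | h
    · left; rw [h]; exact hvw
    · right; rw [h]; exact hvw
  obtain ⟨c₁, hc₁, hne⟩ : ∃ c₁ ∈ J₀ \ F, c₁ ≠ c₀ := by
    obtain ⟨a, ha, b, hb, hab⟩ := one_lt_card.1 (by omega : 1 < (J₀ \ F).card)
    by_cases hac : a = c₀
    · exact ⟨b, hb, fun h => hab (hac.trans h.symm)⟩
    · exact ⟨a, ha, hac⟩
  -- the reads of `w₂` (B-I)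
  have hall := chords_read_of_one_local I hI hT hS hE hU' hF hP hmax hchord hun hc₀ hread₀
  -- the reader releasing the read chord `c₀`
  obtain ⟨A, hAG, -, hAT3, hArel⟩ := hloc c₀ (mem_sdiff.1 hc₀).1
  have gfA : ∀ e ∈ J₀ \ F, ∀ g ∈ A.2.1, I.vars g 2 ≠ I.vars e 2 ∧ I.vars g 3 ≠ I.vars e 2 ∧ I.vars g 2 ≠ I.vars e 3 ∧ I.vars g 3 ≠ I.vars e 3 := by
    intro e he g hg
    rw [hAG] at hg
    have h2 := hun g (mem_union_left _ hg) _ ((mem_privs I).2 ⟨e, he, Or.inl rfl⟩)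
    have h3 := hun g (mem_union_left _ hg) _ ((mem_privs I).2 ⟨e, he, Or.inr rfl⟩)
    exact ⟨h2.1, h2.2, h3.1, h3.2⟩
  have pin : ∀ x x' : Fin n → Bool, (∀ j ∈ J₀, I.eval x j = y j) → gval I w₂.1 w₂.2.1 x = w₂.2.2 →
      (∀ j ∈ J₀, I.eval x' j = y j) → gval I w₂.1 w₂.2.1 x' = w₂.2.2 → gval I A.1 A.2.1 x = gval I A.1 A.2.1 x' := by
    intro x x' hx hxw hx' hx'w
    have e : ∀ a b t : Bool, a ≠ t → b ≠ t → a = b := by decide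
    exact e _ _ A.2.2 (fun h => hAT3 ⟨x, hx, h, hxw⟩) (fun h => hAT3 ⟨x', hx', h, hx'w⟩)
  -- alignment (B-II) and the effective reader
  obtain ⟨ε, hal⟩ := align_reader_local I hI hT hS hE hU' hF hP hmax hchord hun hc₀ hc₁ hne.symm hread₀ A gfA pin
  obtain ⟨R, hbl, hsub, hiff⟩ := exists_effReader I (J₀ := J₀) (F := F) A w₂ ε hal
  have hsub' : R.2.1 ⊆ A₀.2.1 ∪ w₂.2.1 := by rw [← hAG]; exact hsub
  -- transfer of solvability
  have hsp : ∀ E : Finset (Fin m), SatPair I y E A w₂ ↔ SatPair I y E R w₂ := by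
    intro E
    constructor
    · rintro ⟨z, hz, hA, hw⟩; exact ⟨z, hz, (hiff z hw).1 hA, hw⟩
    · rintro ⟨z, hz, hR, hw⟩; exact ⟨z, hz, (hiff z hw).2 hR, hw⟩
  have hdR : Disjoint J₀ R.2.1 := by
    rw [disjoint_left]
    intro g hg hgR
    rcases mem_union.1 (hsub' hgR) with h | h
    · exact disjoint_left.1 hd₀ hg h
    · exact disjoint_left.1 hd₂ hg h
  have hcardR : (J₀ ∪ R.2.1 ∪ w₂.2.1).card ≤ r :=
    (card_le_card (union_subset (union_subset (subset_union_left.trans subset_union_left)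
      (hsub'.trans (union_subset (subset_union_right.trans subset_union_left) subset_union_right))) subset_union_right)).trans hcard
  have hunR : ∀ g ∈ R.2.1 ∪ w₂.2.1, ∀ v ∈ privs I (J₀ \ F), I.vars g 2 ≠ v ∧ I.vars g 3 ≠ v := by
    intro g hg
    rcases mem_union.1 hg with h | h
    · exact hun g (hsub' h)
    · exact hun g (mem_union_right _ h)
  have hT3R : ¬ SatPair I y J₀ R w₂ := fun h => hAT3 ((hsp J₀).2 h)
  obtain ⟨z, -, hzR, hzw⟩ := (hsp _).1 hArel
  -- the dichotomy: `#J₀ ≤ 5`, or no chord releases the reader — but `c₀` does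
  rcases reader_dichotomy I hI hT hS hE y hX hJr hF hP hmax hchord htwo R w₂ hdR hd₂ hcardR hunR hbl hall hT3R ⟨z, hzR, hzw⟩ with h | h
  · exact h
  · exact (h c₀ hc₀ ((hsp _).1 hArel)).elim

end Summit.PneNP.PneNP.Theorems.PstarLocalUnionCaseB
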